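import Mathlib
import Literature.MathematicalPhysics.QuantumLattice.BallSpecification
import Literature.MathematicalPhysics.QuantumLattice.FieldConfigStandardBorel
import Literature.MathematicalPhysics.QuantumLattice.FieldConfigKillInsideSelector
import HarnessLib

/-!
# Proper germ-measurable ball kernels from an a.e. germ-Markov property

Topic `MathematicalPhysics/QuantumLattice` (ball specifications for laws of random distributions, file
`BallSpecification`): THEOREM-ONLY file proving the KERNEL-VERSION LEMMA requested by the route
`CriticalPhenomena/Ising3DConformalLimit/BallSpecification` (crux `BallSpecifiedFieldLimit`, stub
`stub_properGermKernels`): a probability law `μ` on `FieldConfig E = 𝓢'(E)` (`E` finite-dimensional)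
whose conditional probabilities of the events inside an open ball given the events outside the closed
ball admit GERM-measurable versions possesses, for that ball, a kernel `Γ` of probability measures
which is exterior-measurable for every Borel event, EXACTLY germ-measurable on interior events,
proper for EVERY exterior datum, and satisfies the DLR identity `μ (A ∩ B) = ∫_B Γ η A dμ`
(`exists_properGermKernel`). This is the measure-theoretic content of "a Markov random field is
specified by a Röckner-type local specification" (Röckner 1986 §1; Georgii 2011, Def. 1.23 and
Prop. 7.22/7.25 for the conditional-probability mechanism).

## Proof

`𝓢'(E)` is standard Borel (`standardBorelSpace_fieldConfig`), so the regular conditional probability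
kernels `κ = condExpKernel μ 𝓕_ext` and `λ = condExpKernel μ 𝓖` exist. The hypothesis and the
uniqueness of versions give `κ_η A = λ_η A` a.e. for each interior event `A`; interior events are
countably generated (a countable π-system of rational evaluation boxes at a dense sequence of
interior test functions), so off an exterior-measurable null set `N₁` the two kernels agree on ALL
interior events. Properness of `κ_η` holds off a second exterior-measurable null set (the
`0`–`1`-law `κ_η(B) = 1_B(η)` on exterior events, applied to the rational sub-level sets of the
evaluations at a dense sequence of exterior test functions). On the bad set we GLUE: with the
measurable kill-inside selector `P` (`exists_killInside_selector`: `P ξ = ξ` on exterior test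
functions, `P ξ = 0` on interior ones, exterior-measurable in `ξ`) put
`Γ η = (λ_η).map (ξ ↦ ξ - P ξ + P η)`; elsewhere `Γ η = κ_η`. Then `Γ η A = λ_η A` for interior
`A` and every `η` (exact germ measurability), `Γ η` is proper for every `η`, exterior-measurable
(kernel measurability of sections), and `Γ = κ` a.e. (DLR).

Also: generic lemmas on `condExpKernel` for a sub-σ-algebra (`setLIntegral_condExpKernel_eq_inter`,
`condExpKernel_apply_ae_eq_indicator`, adapted from `Literature/Probability/LatticeModels/
GibbsTailDisintegration.lean`), and small measurability lemmas.

## References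

* M. Röckner, Comm. Math. Phys. 106 (1986) 105–135, §1. [Rockner1986]
* H.-O. Georgii, *Gibbs Measures and Phase Transitions*, 2nd ed. (2011), Def. 1.23, Prop. 7.22,
  Prop. 7.25. [Georgii2011]
-/

noncomputable section

namespace Literature.MathematicalPhysics.QuantumLattice

open _root_.MeasureTheory _root_.ProbabilityTheory _root_.TopologicalSpace Set Filter
  _root_.Topology Metric
open scoped ENNReal SchwartzMap

/-! ### Generic lemmas: conditional probability kernels of a sub-σ-algebra -/

section SubSigma

variable {Ω : Type*} {m : MeasurableSpace Ω} [mΩ : MeasurableSpace Ω]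

/-- Two `m`-measurable `ℝ≥0∞`-valued functions with the same integrals over all `m`-measurable sets
(finite measure) agree almost everywhere. [folklore] -/
theorem ae_eq_of_setLIntegral_eq_of_measurable_sub {μ : Measure Ω} [IsFiniteMeasure μ]
    (hm : m ≤ mΩ) {f g : Ω → ℝ≥0∞} (hf : Measurable[m] f) (hg : Measurable[m] g)
    (h : ∀ B, MeasurableSet[m] B → ∫⁻ x in B, f x ∂μ = ∫⁻ x in B, g x ∂μ) : f =ᵐ[μ] g := by
  have h' : f =ᵐ[μ.trim hm] g := by
    refine ae_eq_of_forall_setLIntegral_eq_of_sigmaFinite (μ := μ.trim hm) hf hg ?_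
    intro s hs _
    rw [setLIntegral_trim hm hf hs, setLIntegral_trim hm hg hs]
    exact h s hs
  exact ae_eq_of_ae_eq_trim h'

variable [StandardBorelSpace Ω]

/-- **Defining identity of the conditional probability kernel on rectangles**: for `B ∈ m` and
measurable `A`, `∫_B κ_η(A) dμ = μ (B ∩ A)` where `κ = condExpKernel μ m` (Georgii 2011,
Prop. 7.22 (ii); from Mathlib's `compProd_trim_condExpKernel`). [cite: Georgii2011, Prop. 7.22] -/
theorem setLIntegral_condExpKernel_eq_inter {μ : Measure Ω} [IsFiniteMeasure μ] (hm : m ≤ mΩ)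
    {A B : Set Ω} (hA : MeasurableSet A) (hB : MeasurableSet[m] B) :
    ∫⁻ η in B, condExpKernel μ m η A ∂μ = μ (B ∩ A) := by
  -- adapted from Literature/Probability/LatticeModels/GibbsTailDisintegration.lean
  have key := compProd_trim_condExpKernel (μ := μ) (m := m) hm
  have hrect := Measure.compProd_apply_prod (μ := μ.trim hm) (κ := condExpKernel μ m) hB hA
  have hdiag : @Measurable Ω (Ω × Ω) mΩ (m.prod mΩ) (fun ω => (id ω, id ω)) :=
    (measurable_id.mono le_rfl hm).prodMk measurable_id
  rw [← setLIntegral_trim hm (measurable_condExpKernel hA) hB, ← hrect, key,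
    Measure.map_apply hdiag (hB.prod hA)]
  rfl

/-- **The conditional kernel is `0`–`1` on the conditioning events**: for `B ∈ m`,
`κ_η(B) = 1_B(η)` for `μ`-a.e. `η` (Georgii 2011, Prop. 7.25). [cite: Georgii2011, Prop. 7.25] -/
theorem condExpKernel_apply_ae_eq_indicator {μ : Measure Ω} [IsFiniteMeasure μ] (hm : m ≤ mΩ)
    {B : Set Ω} (hB : MeasurableSet[m] B) :
    ∀ᵐ ω ∂μ, condExpKernel μ m ω B = B.indicator 1 ω := by
  -- adapted from Literature/Probability/LatticeModels/GibbsTailDisintegration.lean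
  have hBm : MeasurableSet B := hm _ hB
  have hBc : MeasurableSet[m] Bᶜ := hB.compl
  have h1 : ∀ᵐ ω ∂μ, ω ∈ B → condExpKernel μ m ω Bᶜ = 0 := by
    rw [← ae_restrict_iff' hBm]
    refine (lintegral_eq_zero_iff ((measurable_condExpKernel hBm.compl).mono hm le_rfl)).1 ?_
    rw [setLIntegral_condExpKernel_eq_inter hm hBm.compl hB, Set.inter_compl_self, measure_empty]
  have h2 : ∀ᵐ ω ∂μ, ω ∈ Bᶜ → condExpKernel μ m ω B = 0 := by
    rw [← ae_restrict_iff' hBm.compl]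
    refine (lintegral_eq_zero_iff ((measurable_condExpKernel hBm).mono hm le_rfl)).1 ?_
    rw [setLIntegral_condExpKernel_eq_inter hm hBm hBc, Set.compl_inter_self, measure_empty]
  filter_upwards [h1, h2] with ω hω1 hω2
  by_cases hω : ω ∈ B
  · rw [Set.indicator_of_mem hω, Pi.one_apply, ← prob_compl_eq_zero_iff hBm]
    exact hω1 hω
  · rw [Set.indicator_of_notMem hω]
    exact hω2 hω

end SubSigma

/-! ### Generic measurability lemmas -/

section Measurability

/-- Sections of a pushforward kernel: if `G : α × β → β` is jointly measurable, then
`a ↦ ((κ a).map (G a)) A` is measurable. [folklore] -/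
theorem measurable_map_apply_of_uncurry {α β : Type*} {mα : MeasurableSpace α}
    {mβ : MeasurableSpace β} (κ : Kernel α β) [IsSFiniteKernel κ] {G : α → β → β}
    (hG : Measurable (Function.uncurry G)) {A : Set β} (hA : MeasurableSet A) :
    Measurable fun a => (κ a).map (G a) A := by
  have h : (fun a => (κ a).map (G a) A) =
      fun a => κ a (Prod.mk a ⁻¹' (Function.uncurry G ⁻¹' A)) := by
    funext a
    rw [Measure.map_apply (f := G a) (show Measurable (G a) from hG.comp measurable_prodMk_left) hA]
    rfl
  rw [h]
  exact Kernel.measurable_kernel_prodMk_left (hG hA)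

/-- A piecewise definition from two measurable functions along a measurable set is measurable.
[folklore] -/
theorem measurable_ite_of_measurable {α : Type*} {mα : MeasurableSpace α} {S : Set α}
    [DecidablePred (· ∈ S)] (hS : MeasurableSet S) {f g : α → ℝ≥0∞} (hf : Measurable f)
    (hg : Measurable g) : Measurable fun a => if a ∈ S then f a else g a :=
  Measurable.ite hS hf hg

/-- The disagreement set of two measurable `ℝ≥0∞`-valued functions is measurable. [folklore] -/
theorem measurableSet_setOf_ne {α : Type*} {mα : MeasurableSpace α} {f g : α → ℝ≥0∞}
    (hf : Measurable f) (hg : Measurable g) : MeasurableSet {a | f a ≠ g a} :=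
  (measurableSet_eq_fun hf hg).compl

/-- The set where a measurable function equals the indicator of a measurable set is measurable.
[folklore] -/
theorem measurableSet_setOf_indicatorLike {α : Type*} {mα : MeasurableSpace α} {B : Set α}
    (hB : MeasurableSet B) {f : α → ℝ≥0∞} (hf : Measurable f) :
    MeasurableSet {a | (a ∈ B → f a = 1) ∧ (a ∉ B → f a = 0)} := by
  have h1 : {a | (a ∈ B → f a = 1) ∧ (a ∉ B → f a = 0)} =
      (Bᶜ ∪ f ⁻¹' {1}) ∩ (B ∪ f ⁻¹' {0}) := by
    ext a
    simp only [Set.mem_setOf_eq, Set.mem_inter_iff, Set.mem_union, Set.mem_compl_iff,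
      Set.mem_preimage, Set.mem_singleton_iff]
    tauto
  rw [h1]
  exact (hB.compl.union (hf (measurableSet_singleton 1))).inter
    (hB.union (hf (measurableSet_singleton 0)))

/-- A map which fixes every generating evaluation fixes every event of the generated σ-algebra:
if `e i ∘ g = e i` for all `i` with `p i`, then `g ⁻¹' A = A` for every `A` measurable for
`⨆ (i) (_ : p i), comap (e i)`. [folklore] -/
theorem preimage_eq_self_of_measurableSet_iSup_comap {Ω ι : Type*} (e : ι → Ω → ℝ) (p : ι → Prop)
    (g : Ω → Ω) (hg : ∀ i, p i → ∀ ω, e i (g ω) = e i ω) {A : Set Ω}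
    (hA : MeasurableSet[⨆ (i : ι) (_ : p i), MeasurableSpace.comap (e i) (borel ℝ)] A) :
    g ⁻¹' A = A := by
  let M : MeasurableSpace Ω :=
    { MeasurableSet' := fun s => g ⁻¹' s = s
      measurableSet_empty := rfl
      measurableSet_compl := fun s hs => by
        change g ⁻¹' s = s at hs
        rw [Set.preimage_compl, hs]
      measurableSet_iUnion := fun f hf => by
        change ∀ i, g ⁻¹' f i = f i at hf
        rw [Set.preimage_iUnion]
        exact Set.iUnion_congr hf }
  have hle : (⨆ (i : ι) (_ : p i), MeasurableSpace.comap (e i) (borel ℝ)) ≤ M := by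
    refine iSup₂_le fun i hi => ?_
    refine MeasurableSpace.comap_le_iff_le_map.2 fun s _ => ?_
    change g ⁻¹' (e i ⁻¹' s) = e i ⁻¹' s
    ext ω
    simp only [Set.mem_preimage, hg i hi ω]
  exact hle A hA

/-- The rational evaluation boxes of a sequence of real functions form a π-system. [folklore] -/
theorem isPiSystem_range_biInter_lt {Ω : Type*} (e : ℕ → Ω → ℝ) :
    IsPiSystem (Set.range fun F : Finset (ℕ × ℚ) => ⋂ t ∈ F, {ω : Ω | e t.1 ω < (t.2 : ℝ)}) := by
  classical
  rintro _ ⟨F, rfl⟩ _ ⟨F', rfl⟩ _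
  refine ⟨F ∪ F', ?_⟩
  ext ω
  simp only [Set.mem_iInter, Set.mem_inter_iff, Finset.mem_union, Set.mem_setOf_eq]
  constructor
  · intro h
    exact ⟨fun t ht => h t (Or.inl ht), fun t ht => h t (Or.inr ht)⟩
  · rintro ⟨h1, h2⟩ t (ht | ht)
    exacts [h1 t ht, h2 t ht]

/-- The rational evaluation boxes of a sequence of real functions (a COUNTABLE family) generate the
σ-algebra generated by the functions. [folklore] -/
theorem generateFrom_range_biInter_lt {Ω : Type*} (e : ℕ → Ω → ℝ) :
    MeasurableSpace.generateFrom
        (Set.range fun F : Finset (ℕ × ℚ) => ⋂ t ∈ F, {ω : Ω | e t.1 ω < (t.2 : ℝ)}) =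
      ⨆ n, MeasurableSpace.comap (e n) (borel ℝ) := by
  classical
  apply le_antisymm
  · refine MeasurableSpace.generateFrom_le ?_
    rintro _ ⟨F, rfl⟩
    refine Finset.measurableSet_biInter F fun t _ => ?_
    have hmeas : Measurable[⨆ n, MeasurableSpace.comap (e n) (borel ℝ)] (e t.1) := by
      refine @Measurable.of_comap_le _ _ (⨆ n, MeasurableSpace.comap (e n) (borel ℝ)) _ _ ?_
      exact le_iSup (fun n => MeasurableSpace.comap (e n) (borel ℝ)) t.1
    exact hmeas measurableSet_Iio
  · refine iSup_le fun n => ?_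
    rw [Real.borel_eq_generateFrom_Iio_rat, MeasurableSpace.comap_generateFrom]
    refine MeasurableSpace.generateFrom_le ?_
    rintro _ ⟨S, hS, rfl⟩
    simp only [Set.mem_iUnion, Set.mem_singleton_iff] at hS
    obtain ⟨q, rfl⟩ := hS
    refine MeasurableSpace.measurableSet_generateFrom ⟨{(n, q)}, ?_⟩
    ext ω
    simp

end Measurability

/-! ### The kernel-version lemma -/

section Construction

variable {E : Type*} [NormedAddCommGroup E] [NormedSpace ℝ E]

/-- Two configurations which agree on a sequence of test functions agree on its closure (both are
continuous on `𝓢`). [folklore] -/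
theorem apply_eq_of_forall_seq {ω η : FieldConfig E} {z : ℕ → 𝓢(E, ℝ)} (h : ∀ n, ω (z n) = η (z n))
    {f : 𝓢(E, ℝ)} (hf : f ∈ closure (Set.range z)) : ω f = η f := by
  have hcl : IsClosed {g : 𝓢(E, ℝ) | ω g = η g} := isClosed_eq ω.continuous η.continuous
  exact hcl.closure_subset_iff.2 (by rintro _ ⟨n, rfl⟩; exact h n) hf

/-- Joint measurability of the gluing map `(η, ξ) ↦ T ξ + P η` for a measurable vector-valued `P`
on a parameter space and a Borel map `T` of configurations (checked on evaluations, since the Borel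
σ-algebra of `𝓢'(E)` is generated by them). [folklore] -/
theorem measurable_glue [FiniteDimensional ℝ E] {α : Type*} {mα : MeasurableSpace α}
    {P : α → FieldConfig E} (hP : Measurable P) {T : FieldConfig E → FieldConfig E}
    (hT : Measurable T) : Measurable fun p : α × FieldConfig E => T p.2 + P p.1 := by
  refine measurable_fieldConfig_iff.2 fun f => ?_
  change Measurable fun p : α × FieldConfig E => T p.2 f + P p.1 f
  exact ((measurable_eval f).comp (hT.comp measurable_snd)).add
    ((measurable_eval f).comp (hP.comp measurable_fst))

/-- **Kernel-version lemma (Ising-free measure theory on `𝓢'(E)`).** Let `μ` be a probability law on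
`FieldConfig E` (`E` finite-dimensional), `c ∈ E`, `r ∈ ℝ`, and suppose every interior event
`A ∈ extEvents (ball c r)` has a `germEvents c r`-measurable version `g` of its conditional
probability given the exterior events (`μ (A ∩ B) = ∫_B g dμ` for all `B ∈ extEvents (closedBall c r)ᶜ`).
Then there is a kernel `Γ : FieldConfig E → Measure (FieldConfig E)` of probability measures,
exterior-measurable on every Borel event, EXACTLY germ-measurable on interior events, proper for
EVERY datum (`Γ η`-a.e. `ω` agrees with `η` on all test functions supported in `(closedBall c r)ᶜ`),
with the DLR identity `μ (A ∩ B) = ∫_B Γ η A dμ`. (Regular conditional probabilities on the standard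
Borel space `𝓢'(E)`, countable generation of the interior events, the `0`–`1` law on exterior events,
and gluing on the null set by the measurable kill-inside selector; see the module docstring.)
[cite: Rockner1986, §1] -/
theorem exists_properGermKernel [FiniteDimensional ℝ E] (μ : Measure (FieldConfig E))
    [IsProbabilityMeasure μ] (c : E) (r : ℝ)
    (hMarkov : ∀ A : Set (FieldConfig E), MeasurableSet[extEvents (ball c r)] A →
      ∃ g : FieldConfig E → ℝ≥0∞, Measurable[germEvents c r] g ∧
        ∀ B : Set (FieldConfig E), MeasurableSet[extEvents (closedBall c r)ᶜ] B →
          μ (A ∩ B) = ∫⁻ η in B, g η ∂μ) :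
    ∃ Γ : FieldConfig E → Measure (FieldConfig E),
      (∀ η, IsProbabilityMeasure (Γ η)) ∧
      (∀ A, MeasurableSet A → Measurable[extEvents (closedBall c r)ᶜ] fun η => Γ η A) ∧
      (∀ A, MeasurableSet[extEvents (ball c r)] A →
        Measurable[germEvents c r] fun η => Γ η A) ∧
      (∀ η, ∀ᵐ ω ∂Γ η, ∀ f : 𝓢(E, ℝ), tsupport f ⊆ (closedBall c r)ᶜ → ω f = η f) ∧
      ∀ A, MeasurableSet A → ∀ B, MeasurableSet[extEvents (closedBall c r)ᶜ] B →
        μ (A ∩ B) = ∫⁻ η in B, Γ η A ∂μ := by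
  classical
  haveI : StandardBorelSpace (FieldConfig E) := standardBorelSpace_fieldConfig
  -- the regions and their σ-algebras
  have hUB : Disjoint (closedBall c r)ᶜ (ball c r) :=
    disjoint_compl_left.mono_right ball_subset_closedBall
  have hmE_le : extEvents (E := E) (closedBall c r)ᶜ ≤ FieldConfig.instMeasurableSpace :=
    extEvents_le _
  have hmI_le : extEvents (E := E) (ball c r) ≤ FieldConfig.instMeasurableSpace := extEvents_le _
  have hGE : germEvents (E := E) c r ≤ extEvents (closedBall c r)ᶜ :=
    germEvents_le_extEvents_compl c r
  have hmG_le : germEvents (E := E) c r ≤ FieldConfig.instMeasurableSpace := hGE.trans hmE_le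
  -- the defining identities of the two regular conditional probability kernels
  have hκint : ∀ A B, MeasurableSet A → MeasurableSet[extEvents (closedBall c r)ᶜ] B →
      ∫⁻ η in B, condExpKernel μ (extEvents (closedBall c r)ᶜ) η A ∂μ = μ (A ∩ B) := by
    intro A B hA hB
    rw [setLIntegral_condExpKernel_eq_inter hmE_le hA hB, Set.inter_comm]
  have hlamint : ∀ A B, MeasurableSet A → MeasurableSet[germEvents c r] B →
      ∫⁻ η in B, condExpKernel μ (germEvents c r) η A ∂μ = μ (A ∩ B) := by
    intro A B hA hB
    rw [setLIntegral_condExpKernel_eq_inter hmG_le hA hB, Set.inter_comm]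
  -- the two kernels agree a.e. on each interior event (hypothesis + uniqueness of versions)
  have hkaplam : ∀ A, MeasurableSet[extEvents (ball c r)] A →
      (fun η => condExpKernel μ (extEvents (closedBall c r)ᶜ) η A) =ᵐ[μ]
        fun η => condExpKernel μ (germEvents c r) η A := by
    intro A hA
    obtain ⟨g, hg, hgint⟩ := hMarkov A hA
    have hAΩ : MeasurableSet A := hmI_le A hA
    have h1 : (fun η => condExpKernel μ (extEvents (closedBall c r)ᶜ) η A) =ᵐ[μ] g :=
      ae_eq_of_setLIntegral_eq_of_measurable_sub hmE_le (measurable_condExpKernel hAΩ)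
        (hg.mono hGE le_rfl) fun B hB => by rw [hκint A B hAΩ hB, hgint B hB]
    have h2 : (fun η => condExpKernel μ (germEvents c r) η A) =ᵐ[μ] g :=
      ae_eq_of_setLIntegral_eq_of_measurable_sub hmG_le (measurable_condExpKernel hAΩ) hg
        fun B hB => by rw [hlamint A B hAΩ hB, hgint B (hGE B hB)]
    exact h1.trans h2.symm
  -- dense sequences of interior and of exterior test functions
  obtain ⟨zB, hzB, hzBd⟩ := exists_denseSeq_subset (E := E) {f : 𝓢(E, ℝ) | tsupport f ⊆ ball c r}
    (tsupport_zero_subset _)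
  obtain ⟨zU, hzU, hzUd⟩ := exists_denseSeq_subset (E := E)
    {f : 𝓢(E, ℝ) | tsupport f ⊆ (closedBall c r)ᶜ} (tsupport_zero_subset _)
  simp only [Set.mem_setOf_eq] at hzB hzU
  -- interior events: a countable generating π-system of rational evaluation boxes
  obtain ⟨Pib, hPib⟩ : ∃ Pib : Set (Set (FieldConfig E)), Pib = Set.range fun F : Finset (ℕ × ℚ) =>
      ⋂ t ∈ F, {ω : FieldConfig E | (fun n (ω : FieldConfig E) => ω (zB n)) t.1 ω < (t.2 : ℝ)} :=
    ⟨_, rfl⟩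
  have hPib_pi : IsPiSystem Pib := by
    rw [hPib]
    exact isPiSystem_range_biInter_lt (fun n (ω : FieldConfig E) => ω (zB n))
  have hPib_gen : extEvents (E := E) (ball c r) = MeasurableSpace.generateFrom Pib := by
    rw [hPib, generateFrom_range_biInter_lt (fun n (ω : FieldConfig E) => ω (zB n))]
    refine le_antisymm ?_ ?_
    · exact iSup₂_le fun f hf => comap_eval_le_evalSigma_of_mem_closure (hzBd hf)
    · exact iSup_le fun n => (measurable_eval_of_tsupport_subset (hzB n)).comap_le
  have hS_meas : ∀ F : Finset (ℕ × ℚ), MeasurableSet[extEvents (ball c r)]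
      (⋂ t ∈ F, {ω : FieldConfig E | (fun n (ω : FieldConfig E) => ω (zB n)) t.1 ω < (t.2 : ℝ)}) :=
    fun F => Finset.measurableSet_biInter F fun t _ =>
      (measurable_eval_of_tsupport_subset (hzB t.1)) measurableSet_Iio
  -- first bad set: where the kernels disagree on some box
  obtain ⟨N₁, hN₁⟩ : ∃ N₁ : Set (FieldConfig E), N₁ = ⋃ F : Finset (ℕ × ℚ), {η |
      condExpKernel μ (extEvents (closedBall c r)ᶜ) η
          (⋂ t ∈ F, {ω : FieldConfig E | (fun n (ω : FieldConfig E) => ω (zB n)) t.1 ω < (t.2 : ℝ)}) ≠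
        condExpKernel μ (germEvents c r) η
          (⋂ t ∈ F, {ω : FieldConfig E |
            (fun n (ω : FieldConfig E) => ω (zB n)) t.1 ω < (t.2 : ℝ)})} := ⟨_, rfl⟩
  have hN₁_meas : MeasurableSet[extEvents (closedBall c r)ᶜ] N₁ := by
    rw [hN₁]
    refine MeasurableSet.iUnion fun F => ?_
    exact measurableSet_setOf_ne (mα := extEvents (closedBall c r)ᶜ)
      (measurable_condExpKernel (hmI_le _ (hS_meas F)))
      ((measurable_condExpKernel (m := germEvents c r) (hmI_le _ (hS_meas F))).mono hGE le_rfl)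
  have hN₁_null : μ N₁ = 0 := by
    rw [hN₁]
    refine measure_iUnion_null_iff.2 fun F => ?_
    exact ae_iff.1 (hkaplam _ (hS_meas F))
  have hN₁_out : ∀ η, η ∉ N₁ → ∀ A, MeasurableSet[extEvents (ball c r)] A →
      condExpKernel μ (extEvents (closedBall c r)ᶜ) η A = condExpKernel μ (germEvents c r) η A := by
    intro η hη
    rw [hN₁] at hη
    have hηF : ∀ F : Finset (ℕ × ℚ),
        condExpKernel μ (extEvents (closedBall c r)ᶜ) η
            (⋂ t ∈ F, {ω : FieldConfig E | (fun n (ω : FieldConfig E) => ω (zB n)) t.1 ω < (t.2 : ℝ)}) =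
          condExpKernel μ (germEvents c r) η
            (⋂ t ∈ F, {ω : FieldConfig E |
              (fun n (ω : FieldConfig E) => ω (zB n)) t.1 ω < (t.2 : ℝ)}) := by
      intro F
      by_contra hne
      exact hη (Set.mem_iUnion.2 ⟨F, hne⟩)
    intro A hA
    refine MeasurableSpace.induction_on_inter (m := extEvents (ball c r))
      (C := fun A _ => condExpKernel μ (extEvents (closedBall c r)ᶜ) η A =
        condExpKernel μ (germEvents c r) η A) hPib_gen hPib_pi ?_ ?_ ?_ ?_ A hA
    · simp only [measure_empty]
    · intro t ht
      rw [hPib] at ht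
      obtain ⟨F, rfl⟩ := ht
      exact hηF F
    · intro t ht h
      rw [prob_compl_eq_one_sub (hmI_le t ht), prob_compl_eq_one_sub (hmI_le t ht), h]
    · intro f hdisj hfm hC
      rw [measure_iUnion hdisj (fun i => hmI_le _ (hfm i)),
        measure_iUnion hdisj (fun i => hmI_le _ (hfm i))]
      exact tsum_congr hC
  -- second bad set: where the exterior kernel is not proper
  have hT_meas : ∀ (n : ℕ) (q : ℚ), MeasurableSet[extEvents (closedBall c r)ᶜ]
      {ω : FieldConfig E | ω (zU n) < (q : ℝ)} :=
    fun n q => (measurable_eval_of_tsupport_subset (hzU n)) measurableSet_Iio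
  obtain ⟨Good₂, hGood₂⟩ : ∃ Good₂ : Set (FieldConfig E), Good₂ = {η | ∀ (n : ℕ) (q : ℚ),
      (η ∈ {ω : FieldConfig E | ω (zU n) < (q : ℝ)} →
        condExpKernel μ (extEvents (closedBall c r)ᶜ) η
          {ω : FieldConfig E | ω (zU n) < (q : ℝ)} = 1) ∧
      (η ∉ {ω : FieldConfig E | ω (zU n) < (q : ℝ)} →
        condExpKernel μ (extEvents (closedBall c r)ᶜ) η
          {ω : FieldConfig E | ω (zU n) < (q : ℝ)} = 0)} := ⟨_, rfl⟩
  have hGood₂_meas : MeasurableSet[extEvents (closedBall c r)ᶜ] Good₂ := by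
    rw [hGood₂]
    simp only [Set.setOf_forall]
    refine MeasurableSet.iInter fun n => MeasurableSet.iInter fun q => ?_
    exact measurableSet_setOf_indicatorLike (mα := extEvents (closedBall c r)ᶜ) (hT_meas n q)
      (measurable_condExpKernel (hmE_le _ (hT_meas n q)))
  have hGood₂_ae : ∀ᵐ η ∂μ, η ∈ Good₂ := by
    have h := ae_all_iff.2 fun n : ℕ => ae_all_iff.2 fun q : ℚ =>
      condExpKernel_apply_ae_eq_indicator (μ := μ) hmE_le (hT_meas n q)
    filter_upwards [h] with η hη
    rw [hGood₂]
    refine fun n q => ⟨fun hmem => ?_, fun hnot => ?_⟩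
    · rw [hη n q, Set.indicator_of_mem hmem, Pi.one_apply]
    · rw [hη n q, Set.indicator_of_notMem hnot]
  have hproper_good : ∀ η ∈ Good₂, ∀ᵐ ω ∂(condExpKernel μ (extEvents (closedBall c r)ᶜ) η),
      ∀ f : 𝓢(E, ℝ), tsupport f ⊆ (closedBall c r)ᶜ → ω f = η f := by
    intro η hη
    rw [hGood₂] at hη
    -- the kernel measure sees no disagreement with `η` on any `zU n`
    have hz : ∀ n, condExpKernel μ (extEvents (closedBall c r)ᶜ) η
        {ω : FieldConfig E | ω (zU n) ≠ η (zU n)} = 0 := by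
      intro n
      have hdis : ∀ q : ℚ, condExpKernel μ (extEvents (closedBall c r)ᶜ) η
          {ω : FieldConfig E | (ω (zU n) < (q : ℝ)) ≠ (η (zU n) < (q : ℝ))} = 0 := by
        intro q
        by_cases hq : η (zU n) < (q : ℝ)
        · have h1 : condExpKernel μ (extEvents (closedBall c r)ᶜ) η
              {ω : FieldConfig E | ω (zU n) < (q : ℝ)}ᶜ = 0 :=
            (prob_compl_eq_zero_iff (hmE_le _ (hT_meas n q))).2 ((hη n q).1 hq)
          refine measure_mono_null (fun ω hω => ?_) h1
          simp only [Set.mem_setOf_eq, ne_eq, eq_iff_iff, hq, iff_true] at hω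
          exact hω
        · have h0 := (hη n q).2 hq
          refine measure_mono_null (fun ω hω => ?_) h0
          simp only [Set.mem_setOf_eq, ne_eq, eq_iff_iff, hq, iff_false, not_not] at hω
          exact hω
      refine measure_mono_null (fun ω hω => ?_) (measure_iUnion_null_iff.2 hdis)
      simp only [Set.mem_setOf_eq] at hω
      rcases lt_or_gt_of_ne hω with hlt | hgt
      · obtain ⟨q, hq1, hq2⟩ := exists_rat_btwn hlt
        refine Set.mem_iUnion.2 ⟨q, ?_⟩
        simp only [Set.mem_setOf_eq, ne_eq, eq_iff_iff]
        exact fun h => (not_lt.2 hq2.le) (h.1 hq1)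
      · obtain ⟨q, hq1, hq2⟩ := exists_rat_btwn hgt
        refine Set.mem_iUnion.2 ⟨q, ?_⟩
        simp only [Set.mem_setOf_eq, ne_eq, eq_iff_iff]
        exact fun h => (not_lt.2 hq2.le) (h.2 hq1)
    have hall : condExpKernel μ (extEvents (closedBall c r)ᶜ) η
        {ω : FieldConfig E | ∃ n, ω (zU n) ≠ η (zU n)} = 0 := by
      have : {ω : FieldConfig E | ∃ n, ω (zU n) ≠ η (zU n)} =
          ⋃ n, {ω : FieldConfig E | ω (zU n) ≠ η (zU n)} := by
        ext ω; simp
      rw [this]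
      exact measure_iUnion_null_iff.2 hz
    rw [ae_iff]
    refine measure_mono_null (fun ω hω => ?_) hall
    simp only [Set.mem_setOf_eq] at hω ⊢
    by_contra hcon
    push Not at hcon
    exact hω fun f hf => apply_eq_of_forall_seq hcon (hzUd hf)
  -- the selector and the gluing map
  obtain ⟨P, hP1, hP2, hPm⟩ := exists_killInside_selector (E := E) hUB
  have hPvec : Measurable[extEvents (closedBall c r)ᶜ] P :=
    (measurable_fieldConfig_iff (mα := extEvents (closedBall c r)ᶜ)).2 hPm
  have hPvecΩ : Measurable P := hPvec.mono hmE_le le_rfl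
  have hT_meas' : Measurable fun ξ : FieldConfig E => ξ - P ξ := by
    refine measurable_fieldConfig_iff.2 fun f => ?_
    change Measurable fun ξ : FieldConfig E => ξ f - P ξ f
    exact (measurable_eval f).sub ((measurable_eval f).comp hPvecΩ)
  obtain ⟨G, hG⟩ : ∃ G : FieldConfig E → FieldConfig E → FieldConfig E,
      G = fun η ξ => ξ - P ξ + P η := ⟨_, rfl⟩
  have hG_apply : ∀ η ξ (f : 𝓢(E, ℝ)), G η ξ f = ξ f - P ξ f + P η f := by
    intro η ξ f
    rw [hG]
    rfl
  have hGη : ∀ η, Measurable (G η) := by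
    intro η
    refine measurable_fieldConfig_iff.2 fun f => ?_
    have : (fun ξ => G η ξ f) = fun ξ : FieldConfig E => ξ f - P ξ f + P η f :=
      funext fun ξ => hG_apply η ξ f
    rw [this]
    exact ((measurable_eval f).sub ((measurable_eval f).comp hPvecΩ)).add_const _
  have hGunc : Measurable[(extEvents (closedBall c r)ᶜ).prod FieldConfig.instMeasurableSpace]
      (Function.uncurry G) := by
    rw [hG]
    exact measurable_glue (mα := extEvents (closedBall c r)ᶜ) hPvec hT_meas'
  -- the germ kernel viewed as an exterior kernel
  let lamE : @Kernel (FieldConfig E) (FieldConfig E) (extEvents (closedBall c r)ᶜ) _ :=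
    Kernel.comap (condExpKernel μ (germEvents c r)) id (measurable_id'' hGE)
  have hglue_meas : ∀ A, MeasurableSet A → Measurable[extEvents (closedBall c r)ᶜ]
      fun η => ((condExpKernel μ (germEvents c r) η).map (G η)) A :=
    fun A hA => measurable_map_apply_of_uncurry (mα := extEvents (closedBall c r)ᶜ) lamE hGunc hA
  -- the kernel
  obtain ⟨Bad, hBad⟩ : ∃ Bad : Set (FieldConfig E), Bad = N₁ ∪ Good₂ᶜ := ⟨_, rfl⟩
  have hBad_meas : MeasurableSet[extEvents (closedBall c r)ᶜ] Bad := by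
    rw [hBad]
    exact hN₁_meas.union hGood₂_meas.compl
  have hBad_null : μ Bad = 0 := by
    rw [hBad]
    refine measure_union_null hN₁_null ?_
    exact ae_iff.1 hGood₂_ae
  obtain ⟨Γ, hΓ⟩ : ∃ Γ : FieldConfig E → Measure (FieldConfig E), Γ = fun η =>
      if η ∈ Bad then (condExpKernel μ (germEvents c r) η).map (G η)
      else condExpKernel μ (extEvents (closedBall c r)ᶜ) η := ⟨_, rfl⟩
  have hΓ_apply : ∀ η A, Γ η A = if η ∈ Bad then ((condExpKernel μ (germEvents c r) η).map (G η)) A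
      else condExpKernel μ (extEvents (closedBall c r)ᶜ) η A := by
    intro η A
    rw [hΓ]
    dsimp only
    split_ifs <;> rfl
  refine ⟨Γ, ?_, ?_, ?_, ?_, ?_⟩
  · -- (i) probability measures
    intro η
    rw [hΓ]
    dsimp only
    by_cases h : η ∈ Bad
    · rw [if_pos h]
      exact Measure.isProbabilityMeasure_map (hGη η).aemeasurable
    · rw [if_neg h]
      infer_instance
  · -- (ii) exterior measurability on every Borel event
    intro A hA
    have : (fun η => Γ η A) = fun η => if η ∈ Bad then
        ((condExpKernel μ (germEvents c r) η).map (G η)) A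
        else condExpKernel μ (extEvents (closedBall c r)ᶜ) η A := funext fun η => hΓ_apply η A
    rw [this]
    exact measurable_ite_of_measurable (mα := extEvents (closedBall c r)ᶜ) hBad_meas
      (hglue_meas A hA) (measurable_condExpKernel hA)
  · -- (iii) exact germ measurability on interior events
    intro A hA
    have hAΩ : MeasurableSet A := hmI_le A hA
    have hfix : ∀ η, G η ⁻¹' A = A := fun η =>
      preimage_eq_self_of_measurableSet_iSup_comap (fun (f : 𝓢(E, ℝ)) (ω : FieldConfig E) => ω f)
        (fun f => tsupport f ⊆ ball c r) (G η) (fun f hf ω => by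
          rw [hG_apply, hP2 ω f hf, hP2 η f hf]
          ring) hA
    have hΓA : (fun η => Γ η A) = fun η => condExpKernel μ (germEvents c r) η A := by
      funext η
      rw [hΓ_apply]
      by_cases h : η ∈ Bad
      · rw [if_pos h, Measure.map_apply (hGη η) hAΩ, hfix η]
      · rw [if_neg h]
        have hη : η ∉ N₁ := fun hn => h (by rw [hBad]; exact Or.inl hn)
        exact hN₁_out η hη A hA
    rw [hΓA]
    exact measurable_condExpKernel hAΩ
  · -- (iv) properness for every datum
    intro η
    rw [hΓ]
    dsimp only
    by_cases h : η ∈ Bad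
    · rw [if_pos h]
      have hall : ∀ ξ (f : 𝓢(E, ℝ)), tsupport f ⊆ (closedBall c r)ᶜ → G η ξ f = η f := by
        intro ξ f hf
        rw [hG_apply, hP1 ξ f hf, hP1 η f hf]
        ring
      have hS : MeasurableSet (⋂ n, {ω : FieldConfig E | ω (zU n) = η (zU n)}) :=
        MeasurableSet.iInter fun n => measurableSet_eq_fun (measurable_eval _) measurable_const
      have hae : ∀ᵐ ω ∂(condExpKernel μ (germEvents c r) η).map (G η),
          ω ∈ ⋂ n, {ω : FieldConfig E | ω (zU n) = η (zU n)} := by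
        rw [ae_iff]
        have hset : {a : FieldConfig E | a ∉ ⋂ n, {ω : FieldConfig E | ω (zU n) = η (zU n)}} =
            (⋂ n, {ω : FieldConfig E | ω (zU n) = η (zU n)})ᶜ := rfl
        rw [hset, Measure.map_apply (hGη η) hS.compl]
        have : G η ⁻¹' (⋂ n, {ω : FieldConfig E | ω (zU n) = η (zU n)})ᶜ = ∅ := by
          ext ξ
          simp only [Set.mem_preimage, Set.mem_compl_iff, Set.mem_setOf_eq, Set.mem_iInter,
            Set.mem_empty_iff_false, iff_false, not_not]
          exact fun n => hall ξ (zU n) (hzU n)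
        rw [this, measure_empty]
      filter_upwards [hae] with ω hω
      exact fun f hf => apply_eq_of_forall_seq (fun n => Set.mem_iInter.1 hω n) (hzUd hf)
    · rw [if_neg h]
      have hη : η ∈ Good₂ := by
        by_contra hc
        exact h (by rw [hBad]; exact Or.inr hc)
      exact hproper_good η hη
  · -- (v) the DLR identity
    intro A hA B hB
    have hnot : ∀ᵐ η ∂μ, η ∉ Bad := measure_eq_zero_iff_ae_notMem.1 hBad_null
    have hΓκ : (fun η => Γ η A) =ᵐ[μ]
        fun η => condExpKernel μ (extEvents (closedBall c r)ᶜ) η A := by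
      filter_upwards [hnot] with η hη
      rw [hΓ_apply, if_neg hη]
    rw [← hκint A B hA hB]
    exact (lintegral_congr_ae (ae_restrict_of_ae hΓκ)).symm

end Construction

end Literature.MathematicalPhysics.QuantumLattice

end
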